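import Summits.Ventures.DiscreteObjects.Hadamard.ConferenceGraph333Involution

/-!
# Involutions of srg(333,166,82,83) fix at most `165` points (kernel; the `p = 2` row bound)

Framing: lottery ticket; floor = certified bounds/negative ranges.  Cell pub-namedobj (venture DiscreteObjects),
target (H) = `H(668)`, hadamard gen 29 (HANDOFF-H-g28 item 4).  The prime-order census of gen 28
(`ConferenceGraph333PrimeSpectrum`) bounds the fixed points of automorphisms of ODD prime order by the row identity of the
class-sum matrix; here is the `p = 2` companion, by a vector identity that avoids class sums: for the Seidel matrix `S`
(`S² = 333·I − J`) and a moved vertex `x` of an adjacency-preserving involution `τ`, the vector `u = e_x + e_{τx}` has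
`‖S u‖² = uᵀ(333 I − J)u = 666 − 4 = 662`; a fixed vertex `y` contributes `(S_{yx} + S_{y,τx})² = (2S_{yx})² = 4`
(`S_{y,τx} = S_{τy,τx} = S_{yx}`), and `x, τx` contribute `S_{x,τx}² = 1` each, so `4f + 2 ≤ 662`:
* **`involution_fixed_le`** — an involution `τ ≠ 1` has `f ≤ 165` fixed points;
* **`involution_window`** — with `ConferenceGraph333Involution`: `f ≡ 1 (mod 4)` and `f ≤ 165`, i.e. `f ∈ {1, 5, 9, …, 165}`.
(The remaining moved vertices contribute `0` or `4` each, in `τ`-pairs: `165 − f = 2·#{2-orbits j ≠ i : R_{ij} ≠ 0}` for every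
`2`-orbit `i` — not formalised.)  Structure of a HYPOTHETICAL object; ours (PROVISIONAL).  No `sorry`, no new definitions.
-/

namespace Summit.Ventures.DiscreteObjects.Hadamard

open Finset

section invbound
variable {V : Type*} [Fintype V] [DecidableEq V]

/-- **Involutions fix at most `165` points.** -/
theorem involution_fixed_le (hV : Fintype.card V = 333) (A : Matrix V V ℤ)
    (h01 : ∀ x y, A x y = 0 ∨ A x y = 1) (hsymm : ∀ x y, A y x = A x y) (hdiag : ∀ x, A x x = 0)
    (hk : ∀ x, ∑ y, A x y = 166) (hsrg : ∀ x y, ∑ z, A x z * A z y = 83 * (1 + (if x = y then 1 else 0)) - A x y)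
    (τ : Equiv.Perm V) (hτ : ∀ x, τ (τ x) = x) (hτ1 : τ ≠ 1) (hA : ∀ x y, A (τ x) (τ y) = A x y) :
    (univ.filter fun x => τ x = x).card ≤ 165 := by
  obtain ⟨hSd, hSo, hSs, -, hSS⟩ := seidel_identities_of_conferenceGraph A h01 hsymm hdiag 83
    (by rw [hV]; norm_num) (fun x => by rw [hk x]; norm_num) hsrg
  set S : V → V → ℤ := fun x y => 1 - (if x = y then 1 else 0) - 2 * A x y with hS_def
  have hSS' : ∀ x y, ∑ z, S x z * S z y = 333 * (if x = y then 1 else 0) - 1 := fun x y => by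
    rw [hSS x y, hV]; norm_num
  have hSτ : ∀ x y, S (τ x) (τ y) = S x y := fun x y => by
    simp only [hS_def, hA, τ.injective.eq_iff]
  have hSs' : ∀ x y, S y x = S x y := fun x y => hSs x y
  have hSd' : ∀ x, S x x = 0 := fun x => hSd x
  have hSo' : ∀ x y, x ≠ y → S x y = 1 ∨ S x y = -1 := fun x y => hSo x y
  -- a moved vertex
  obtain ⟨x, hx⟩ : ∃ x, τ x ≠ x := by
    by_contra h
    exact hτ1 (Equiv.ext fun y => by by_contra hy; exact h ⟨y, hy⟩)
  -- column inner products: Σ_y S y a * S y b = 333[a=b] − 1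
  have hcol : ∀ a b, ∑ y, S y a * S y b = 333 * (if a = b then 1 else 0) - 1 := by
    intro a b
    rw [Finset.sum_congr rfl fun y _ => by rw [hSs' a y]]
    exact hSS' a b
  -- ‖S(e_x + e_{τx})‖² = 662
  set g : V → ℤ := fun y => S y x + S y (τ x) with hg_def
  have hg2 : ∑ y, g y ^ 2 = 662 := by
    have e : ∀ y, g y ^ 2 = S y x * S y x + 2 * (S y x * S y (τ x)) + S y (τ x) * S y (τ x) := by
      intro y; simp only [hg_def]; ring
    rw [Finset.sum_congr rfl fun y _ => e y, Finset.sum_add_distrib, Finset.sum_add_distrib, ← Finset.mul_sum,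
      hcol, hcol, hcol, if_pos rfl, if_pos rfl, if_neg (fun h => hx h.symm)]
    norm_num
  -- fixed vertices contribute 4 each
  have hfix : ∀ y, τ y = y → g y ^ 2 = 4 := by
    intro y hy
    have h1 : S y (τ x) = S y x := by rw [← hSτ y x, hy]
    have hyx : y ≠ x := fun h => hx (h ▸ hy)
    simp only [hg_def, h1]
    rcases hSo' y x hyx with h | h <;> rw [h] <;> norm_num
  -- the two moved vertices x, τx contribute 1 each
  have hgx : g x ^ 2 = 1 := by
    simp only [hg_def, hSd' x, zero_add]
    rcases hSo' x (τ x) (fun h => hx h.symm) with h | h <;> rw [h] <;> norm_num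
  have hgτx : g (τ x) ^ 2 = 1 := by
    simp only [hg_def, hSd' (τ x), add_zero]
    rcases hSo' (τ x) x hx with h | h <;> rw [h] <;> norm_num
  -- split the sum
  have hsplit := Finset.sum_filter_add_sum_filter_not (univ : Finset V) (fun y => τ y = y) (fun y => g y ^ 2)
  rw [hg2] at hsplit
  have hF : ∑ y ∈ univ.filter (fun y => τ y = y), g y ^ 2 = 4 * (univ.filter fun y => τ y = y).card := by
    rw [Finset.sum_congr rfl fun y hy => hfix y (Finset.mem_filter.mp hy).2, Finset.sum_const, nsmul_eq_mul, mul_comm]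
  have hM : 2 ≤ ∑ y ∈ univ.filter (fun y => ¬ τ y = y), g y ^ 2 := by
    have hsub : ({x, τ x} : Finset V) ⊆ univ.filter (fun y => ¬ τ y = y) := by
      intro y hy
      rw [Finset.mem_insert, Finset.mem_singleton] at hy
      rw [Finset.mem_filter]
      refine ⟨Finset.mem_univ _, ?_⟩
      rcases hy with rfl | rfl
      · exact hx
      · rw [hτ]; exact fun h => hx h.symm
    have hle := Finset.sum_le_sum_of_subset_of_nonneg hsub (fun y _ _ => sq_nonneg (g y))
    have hpair : ∑ y ∈ ({x, τ x} : Finset V), g y ^ 2 = 2 := by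
      rw [Finset.sum_pair (fun h => hx h.symm), hgx, hgτx]; norm_num
    linarith
  have hcardZ : (4 : ℤ) * (univ.filter fun y => τ y = y).card + 2 ≤ 662 := by linarith
  have : ((univ.filter fun y => τ y = y).card : ℤ) ≤ 165 := by linarith
  exact_mod_cast this

/-- **Involution window.**  An involution `τ ≠ 1` of `srg(333,166,82,83)` has `f ≡ 1 (mod 4)` and `f ≤ 165` fixed points. -/
theorem involution_window (hV : Fintype.card V = 333) (A : Matrix V V ℤ)
    (h01 : ∀ x y, A x y = 0 ∨ A x y = 1) (hsymm : ∀ x y, A y x = A x y) (hdiag : ∀ x, A x x = 0)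
    (hk : ∀ x, ∑ y, A x y = 166) (hsrg : ∀ x y, ∑ z, A x z * A z y = 83 * (1 + (if x = y then 1 else 0)) - A x y)
    (τ : Equiv.Perm V) (hτ : ∀ x, τ (τ x) = x) (hτ1 : τ ≠ 1) (hA : ∀ x y, A (τ x) (τ y) = A x y) :
    (univ.filter fun x => τ x = x).card % 4 = 1 ∧ (univ.filter fun x => τ x = x).card ≤ 165 :=
  ⟨involution_fixedPoints_mod_four hV A h01 hsymm hdiag hk hsrg τ hτ hA,
    involution_fixed_le hV A h01 hsymm hdiag hk hsrg τ hτ hτ1 hA⟩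

end invbound

end Summit.Ventures.DiscreteObjects.Hadamard
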